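import Summits.QuantumFields.YangMills.Theorems.BalabanUVNodesN21LowCentreEndAtCubeLaw
import Summits.QuantumFields.YangMills.Theorems.BalabanUVNodesN21CollarJunctionAtBlockFibreLaw

/-!
# N21 (NE7c) · THE LOW-CENTRE ENDs AT ONE BLOCK FIBRE LAW OF THE RECORD (`blockFibreLawOfDatum₉ … t a b x`): chart
# transport of p590709 ★★★ ∕ p592783 ★★★★ through dag-n21-e's 38t `fibreAC_of_chart_dominated` (the sibling of p596527)

Width seat pub-ymgap-dag-n21-w1 (g0; director-ym №197 ∕ HUMAN RULING D-0149), node N21 = NE7c (single-run shell-weight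
bound, NOT PRINTED in [Bałaban 1983–89], NOT proved), lane K3⁷ `SpineGivenEndpointR13SepCoPH` (stmt-QuantumFields-20544,
`--kind proof --supports … --as helper`).  Eighth file of the seat's item-1 chain.  Consumes BY NAME: dag-n21-e 38t
`…N21CollarJunctionAtBlockFibreLaw.fibreAC_of_chart_dominated` (the two-ratio chart dictionary at a block fibre law,
itself over `T4ShellMeasureFibre` and 38s §1), dag-n21-d FILE 5's `blockFibreLawOfDatum₉` (the block fibre of the record's
truncated cube law at a frozen exterior field), and this seat's ENDs p590709 ∕ p592783.

WHAT.  At an exterior field `x` and a bond block `b` of top cube `a`: a chart `Φ : (↥b → SU N) → X × (κ → ℝ)` into the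
[LF-II] (1.2) block frame through which the block statistic `r` factors, the two-ratio dictionary (`hS` ratio `M₁`,
`hmass` ratio `M₂`) against the frame law restricted to the sub-level event, and p590709's binders (θ := ε_k) give ★★★
`fibreAC_of_sect1Letters_chart`: `SlotAntiConcentration (blockFibreLawOfDatum₉ … t a b x) r ε_k ρ
((3(#κ+1)(1+Q)∕(κ₀(1−ρ)))·(M₁·M₂))` — the `hfib` input of 38t ★★ `cubeAC_of_blockFibres` ∕ dag-n21-d FILE 5 ★★★
`slotAntiConcentration_cubeLaw_of_blockFibres` at `x`; ★★★★ `fibreAC_of_chartLetter_chart`: the chart-letter species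
(p592783; geometric binders already discharged; constant `(3(#κ+1)∕(1−ρ))·(M₁·M₂)`).

HONEST FRAMING.  Composition BY NAME; 0 def, 0 sorry; a LOCATED JUNCTION — chart, reading identity, dictionary and the
frame binders are HYPOTHESES (the joint system at NODE 00's objects is not exhibited here); nothing of Bałaban's asserted;
NE7c NOT PRINTED ∕ NOT proved; N21 NOT discharged; counts unmoved (typed 28∕28 · discharged 5∕27); count-neutral; one
finite 𝕋⁴ at fixed ε — R4 would close only the conditional finite-𝕋⁴ rung `BalabanLadder.UV`, NOT the Yang–Mills mass
gap (Clay); nothing about ℝ⁴ ∕ OS.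
-/

set_option autoImplicit false

noncomputable section

open MeasureTheory Set Function Finset
open scoped ENNReal BigOperators

namespace Summit.QuantumFields.YangMills.Theorems.N21LowCentreEndAtBlockFibreLaw

open Literature.MathematicalPhysics.QuantumFieldTheory.Balaban1983to89
open Literature.MathematicalPhysics.QuantumFieldTheory.Balaban1983to89.T4Continuum
open Literature.MathematicalPhysics.QuantumFieldTheory.Balaban1983to89.Node00
open Literature.MathematicalPhysics.QuantumFieldTheory.Balaban1983to89.T4ShellMeasure (SlotAntiConcentration)
open Literature.MathematicalPhysics.QuantumFieldTheory.Balaban1983to89.B16Sect1Wilson (Ineq16 Ineq19)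
open Summit.QuantumFields.YangMills.Theorems.N21ShellSplitOfRecord13CoPH (blockFibreLawOfDatum₉)
open Summit.QuantumFields.YangMills.Theorems.N21CollarJunctionAtCubeLaw (fibreAC_of_chart_dominated)
open Summit.QuantumFields.YangMills.Theorems.N21LowCentreEndSect1Letters (slotAntiConcentration_restrict_of_sect1Letters)
open Summit.QuantumFields.YangMills.Theorems.N21LowCentreEndChartLetter (slotAntiConcentration_chartLetter_of_sect1Letters)

variable (F : T4Family) (N : ℕ) [NeZero N] (ϑ : Stage9Params F N) (Dt : FiniteEpsData F (SU N)) (g₀ : ℕ → ℝ)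
  (os : List (ULoop F)) (p : B12.RunParams) (g : ℕ → ℝ) (k : ℕ)

variable {X : Type*} [MeasurableSpace X] {κ : Type*} [Fintype κ]

/-- ★★★ **THE [LF-II] §1-LETTERS END AT A BLOCK FIBRE LAW.**  p590709's ★★★ frame and binders at `θ := ε_k` (kept convex
cuts ∋ 0, convex exponent + (1.2) identity, PRINTED ROWS `Ineq19`∕`Ineq16` on the chart, remainder value bound,
`L`-Lipschitz statistic with core reading `≤ σε_k`, ONE clause, `henv`∕`hRT`∕`hQ`), a chart `Φ` of `↥b → SU N` into the frame
through which the block statistic `r` factors, and the two-ratio dictionary against the frame law restricted to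
`{U < ε_k} ∩ C` ⇒ `SlotAntiConcentration (blockFibreLawOfDatum₉ … t a b x) r ε_k ρ ((3(#κ+1)(1+Q)∕(κ₀(1−ρ)))·(M₁·M₂))`.
LOCATED junction. [folklore] -/
theorem fibreAC_of_sect1Letters_chart (t : ℝ)
    (a : ↥(cubeIndices (F.P p.K) (cubeSide (F.P p.K).L ϑ.ν.M₂ (RkOfRecord (F.P p.K).L ϑ.ν.r (g k)) k)))
    (b : Finset (PBond (F.P p.K) k)) (x : GaugeField (F.P p.K) k (SU N)) (r : (↥b → SU N) → ℝ)
    (hε : 0 < epsOfRecord ϑ.ν g k)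
    -- the frame and p590709's binders at `θ := ε_k`
    [Nonempty κ] (ζ : Measure X) [SFinite ζ] (K : X → Set (κ → ℝ)) (φ Qf lin Vt : X → (κ → ℝ) → ℝ)
    (hg : Measurable fun q : X × (κ → ℝ) =>
      (K q.1).indicator (fun w => ENNReal.ofReal (Real.exp (-φ q.1 w))) q.2)
    {U : X × (κ → ℝ) → ℝ} (hUm : Measurable U)
    {C Env : Set (X × (κ → ℝ))} (hC : MeasurableSet C) (hEnv : MeasurableSet Env)
    {ρ σ κ₀ Q L γ₀ M B₃ M₀ A₀ p₀g Rk WV M₁ M₂ : ℝ} {d : ℕ}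
    (hρ0 : 0 < ρ) (hρ1 : ρ < 1) (hρσ : ρ + σ ≤ 1) (hκ : 0 < κ₀) (hQ0 : 0 ≤ Q) (hL : 0 < L) (hd : 1 ≤ d) (hM : 0 < M)
    (hγ₀ : 0 < γ₀) (hW : 0 ≤ 3 * B₃ * M₀ * A₀ ^ 2 * p₀g ^ 2 * Real.exp (-Rk) * (100 * M) ^ 4 + WV) (hM₁ : 0 ≤ M₁)
    (hK : ∀ z, Convex ℝ (K z)) (hφ : ∀ z, ConvexOn ℝ (K z) (φ z)) (h0K : ∀ z, (0 : κ → ℝ) ∈ K z)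
    (hexp : ∀ z, ∀ v ∈ K z, φ z v = φ z 0 + 1 / 2 * Qf z v + lin z v + Vt z v)
    (h19 : ∀ z, ∀ v ∈ K z, Ineq19 (Qf z v) (∑ b', v b' ^ 2) γ₀ d M)
    (h16 : ∀ z, ∀ v ∈ K z, Ineq16 (lin z v) B₃ M₀ A₀ p₀g Rk M)
    (hV : ∀ z, ∀ v ∈ K z, |Vt z v| ≤ WV)
    (hU : ∀ z (a' b' : κ → ℝ), U (z, a') - U (z, b') ≤ L * ‖a' - b'‖)
    (hUc : ∀ z, U (z, 0) ≤ σ * epsOfRecord ϑ.ν g k)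
    (hclause : 16 * (3 * B₃ * M₀ * A₀ ^ 2 * p₀g ^ 2 * Real.exp (-Rk) * (100 * M) ^ 4 + WV) * d
      * (100 * M) ^ (d + 1) * L ^ 2 ≤ γ₀ * (epsOfRecord ϑ.ν g k * (1 - ρ - σ)) ^ 2)
    (henv : ∀ l ∈ Icc (1 - 1 / ((Fintype.card κ : ℝ) + 1)) 1, ∀ q : X × (κ → ℝ),
      epsOfRecord ϑ.ν g k * (1 - ρ) ≤ U q → U q < epsOfRecord ϑ.ν g k → q ∈ C →
        (q.1, (0 : κ → ℝ) + l • (q.2 - 0)) ∈ Env)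
    (hRT : ∀ q : X × (κ → ℝ), epsOfRecord ϑ.ν g k * (1 - ρ) ≤ U q → U q < epsOfRecord ϑ.ν g k → q ∈ C →
      ∀ s : ℝ, 1 ≤ s →
      epsOfRecord ϑ.ν g k * (1 - ρ) ≤ U (q.1, (0 : κ → ℝ) + s • (q.2 - 0)) →
        U (q.1, (0 : κ → ℝ) + s • (q.2 - 0)) < epsOfRecord ϑ.ν g k → (q.1, (0 : κ → ℝ) + s • (q.2 - 0)) ∈ C →
          U q + κ₀ * (epsOfRecord ϑ.ν g k * (1 - ρ)) * (s - 1) ≤ U (q.1, (0 : κ → ℝ) + s • (q.2 - 0)))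
    (hQ : ((ζ.prod volume).withDensity fun q : X × (κ → ℝ) =>
        (K q.1).indicator (fun w => ENNReal.ofReal (Real.exp (-φ q.1 w))) q.2)
          (Env \ ({q | U q < epsOfRecord ϑ.ν g k} ∩ C))
      ≤ ENNReal.ofReal Q * ((ζ.prod volume).withDensity fun q : X × (κ → ℝ) =>
        (K q.1).indicator (fun w => ENNReal.ofReal (Real.exp (-φ q.1 w))) q.2) ({q | U q < epsOfRecord ϑ.ν g k} ∩ C))
    -- the block chart, the reading identity and the dictionary
    (Φ : (↥b → SU N) → X × (κ → ℝ)) (hread : ∀ y, r y = U (Φ y))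
    (hS : blockFibreLawOfDatum₉ F N ϑ Dt g₀ os p g k t a b x
        {y | epsOfRecord ϑ.ν g k * (1 - ρ) ≤ U (Φ y) ∧ U (Φ y) < epsOfRecord ϑ.ν g k} ≤
      ENNReal.ofReal M₁ * ((((ζ.prod volume).withDensity fun q : X × (κ → ℝ) =>
          (K q.1).indicator (fun w => ENNReal.ofReal (Real.exp (-φ q.1 w))) q.2)).restrict
            ({q | U q < epsOfRecord ϑ.ν g k} ∩ C))
        {q | epsOfRecord ϑ.ν g k * (1 - ρ) ≤ U q ∧ U q < epsOfRecord ϑ.ν g k})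
    (hmass : ((((ζ.prod volume).withDensity fun q : X × (κ → ℝ) =>
          (K q.1).indicator (fun w => ENNReal.ofReal (Real.exp (-φ q.1 w))) q.2)).restrict
            ({q | U q < epsOfRecord ϑ.ν g k} ∩ C)) Set.univ
      ≤ ENNReal.ofReal M₂ * blockFibreLawOfDatum₉ F N ϑ Dt g₀ os p g k t a b x Set.univ) :
    SlotAntiConcentration (blockFibreLawOfDatum₉ F N ϑ Dt g₀ os p g k t a b x) r (epsOfRecord ϑ.ν g k) ρ
      (3 * ((Fintype.card κ : ℝ) + 1) * (1 + Q) / (κ₀ * (1 - ρ)) * (M₁ * M₂)) := by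
  have hD0 : 0 ≤ 3 * ((Fintype.card κ : ℝ) + 1) * (1 + Q) / (κ₀ * (1 - ρ)) := by
    have : 0 < 1 - ρ := by linarith
    positivity
  exact fibreAC_of_chart_dominated F N ϑ Dt g₀ os p g k t a b x r Φ U hread _ hD0 hρ0.le hM₁ hS hmass
    (slotAntiConcentration_restrict_of_sect1Letters ζ K φ Qf lin Vt hg hUm hC hEnv hε hρ0 hρ1 hρσ hκ hQ0 hL hd hM hγ₀ hW
      hK hφ h0K hexp h19 h16 hV hU hUc hclause henv hRT hQ)

/-- ★★★★ **THE CHART-LETTER SPECIES AT A BLOCK FIBRE LAW.**  p592783's ★★★★ (statistic = the frame's own sup-norm letter,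
geometric binders discharged) + block chart + reading identity + two-ratio dictionary ⇒
`SlotAntiConcentration (blockFibreLawOfDatum₉ … t a b x) r ε_k ρ ((3(#κ+1)∕(1−ρ))·(M₁·M₂))` (written with the frame's
`(1+0)∕(1·(1−ρ))`).  LOCATED junction. [folklore] -/
theorem fibreAC_of_chartLetter_chart (t : ℝ)
    (a : ↥(cubeIndices (F.P p.K) (cubeSide (F.P p.K).L ϑ.ν.M₂ (RkOfRecord (F.P p.K).L ϑ.ν.r (g k)) k)))
    (b : Finset (PBond (F.P p.K) k)) (x : GaugeField (F.P p.K) k (SU N)) (r : (↥b → SU N) → ℝ)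
    (hε : 0 < epsOfRecord ϑ.ν g k)
    [Nonempty κ] (ζ : Measure X) [SFinite ζ] (K : X → Set (κ → ℝ)) (φ Qf lin Vt : X → (κ → ℝ) → ℝ)
    (hg : Measurable fun q : X × (κ → ℝ) =>
      (K q.1).indicator (fun w => ENNReal.ofReal (Real.exp (-φ q.1 w))) q.2)
    {ρ γ₀ M B₃ M₀ A₀ p₀g Rk WV M₁ M₂ : ℝ} {d : ℕ} (hρ0 : 0 < ρ) (hρ1 : ρ < 1) (hd : 1 ≤ d) (hM : 0 < M)
    (hγ₀ : 0 < γ₀) (hW : 0 ≤ 3 * B₃ * M₀ * A₀ ^ 2 * p₀g ^ 2 * Real.exp (-Rk) * (100 * M) ^ 4 + WV) (hM₁ : 0 ≤ M₁)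
    (hK : ∀ z, Convex ℝ (K z)) (hφ : ∀ z, ConvexOn ℝ (K z) (φ z)) (h0K : ∀ z, (0 : κ → ℝ) ∈ K z)
    (hexp : ∀ z, ∀ v ∈ K z, φ z v = φ z 0 + 1 / 2 * Qf z v + lin z v + Vt z v)
    (h19 : ∀ z, ∀ v ∈ K z, Ineq19 (Qf z v) (∑ b', v b' ^ 2) γ₀ d M)
    (h16 : ∀ z, ∀ v ∈ K z, Ineq16 (lin z v) B₃ M₀ A₀ p₀g Rk M)
    (hV : ∀ z, ∀ v ∈ K z, |Vt z v| ≤ WV)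
    (hclause : 16 * (3 * B₃ * M₀ * A₀ ^ 2 * p₀g ^ 2 * Real.exp (-Rk) * (100 * M) ^ 4 + WV) * d
      * (100 * M) ^ (d + 1) ≤ γ₀ * (epsOfRecord ϑ.ν g k * (1 - ρ)) ^ 2)
    (Φ : (↥b → SU N) → X × (κ → ℝ)) (hread : ∀ y, r y = ‖(Φ y).2‖)
    (hS : blockFibreLawOfDatum₉ F N ϑ Dt g₀ os p g k t a b x
        {y | epsOfRecord ϑ.ν g k * (1 - ρ) ≤ ‖(Φ y).2‖ ∧ ‖(Φ y).2‖ < epsOfRecord ϑ.ν g k} ≤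
      ENNReal.ofReal M₁ * ((((ζ.prod volume).withDensity fun q : X × (κ → ℝ) =>
          (K q.1).indicator (fun w => ENNReal.ofReal (Real.exp (-φ q.1 w))) q.2)).restrict
            ({q : X × (κ → ℝ) | ‖q.2‖ < epsOfRecord ϑ.ν g k} ∩ univ))
        {q : X × (κ → ℝ) | epsOfRecord ϑ.ν g k * (1 - ρ) ≤ ‖q.2‖ ∧ ‖q.2‖ < epsOfRecord ϑ.ν g k})
    (hmass : ((((ζ.prod volume).withDensity fun q : X × (κ → ℝ) =>
          (K q.1).indicator (fun w => ENNReal.ofReal (Real.exp (-φ q.1 w))) q.2)).restrict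
            ({q : X × (κ → ℝ) | ‖q.2‖ < epsOfRecord ϑ.ν g k} ∩ univ)) Set.univ
      ≤ ENNReal.ofReal M₂ * blockFibreLawOfDatum₉ F N ϑ Dt g₀ os p g k t a b x Set.univ) :
    SlotAntiConcentration (blockFibreLawOfDatum₉ F N ϑ Dt g₀ os p g k t a b x) r (epsOfRecord ϑ.ν g k) ρ
      (3 * ((Fintype.card κ : ℝ) + 1) * (1 + 0) / (1 * (1 - ρ)) * (M₁ * M₂)) := by
  have hD0 : 0 ≤ 3 * ((Fintype.card κ : ℝ) + 1) * (1 + 0) / (1 * (1 - ρ)) := by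
    have : 0 < 1 - ρ := by linarith
    positivity
  exact fibreAC_of_chart_dominated F N ϑ Dt g₀ os p g k t a b x r Φ (fun q : X × (κ → ℝ) => ‖q.2‖) hread _ hD0
    hρ0.le hM₁ hS hmass
    (slotAntiConcentration_chartLetter_of_sect1Letters ζ K φ Qf lin Vt hg hε hρ0 hρ1 hd hM hγ₀ hW hK hφ h0K hexp h19 h16
      hV hclause)

end Summit.QuantumFields.YangMills.Theorems.N21LowCentreEndAtBlockFibreLaw

end
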